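import Summits.AtomisticToContinuum.FouriersLaw.Theorems.OddSectorIrreversibilityOddCorrectorDecayExpectation

/-!
# The bath-locality estimate, II: bath locality at every admissible parameter point

Support file for item `stmt-AtomisticToContinuum-9139` (`OddSectorIrreversibility.OddCorrectorDecay`), negative
side. We discharge the one hypothesis of the reduction
`OddCorrectorBathLocality.oddCorrectorDecay_false_of_bathLocality_at` (`BathReduction.lean`): at EVERY
admissible parameter point, for every horizon `t₀` and `ε > 0` there is `N` with `M_N > 0` and
`∫ (P_tJ - J∘φ_t)² dμ_T ≤ ε M_N` on `[0, t₀]` (`bathLocality`). Steps: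
1. `lintegral_sq_forecast_sub_le` — Jensen in the Markov kernel, `μ_T`-a.e. (the kernel `P_t(x,·)` is the law
   of the Brownian-driven solution map; the forecast `P_tJ(x)` is an honest `L²` average for a.e. `x`):
   `∫ (P_tJ - J∘φ_t)² dμ_T ≤ ∫ (J(z_t) - J(y_t))² d(μ_T ⊗ P)`.
2. `Expectation.lintegral_sq_currentDiff_le` — the right side is `≤ s³A₁ ∫Ψ dμ_T + (A₂/s⁶) μ_T(univ)` for every
   `s > 0`, with `∫Ψ dμ_T ≤ C_Ψ N μ_T(univ)` (`WeightMoments`) while `M_N ≥ c (N-2) μ_T(univ)`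
   (`WeightMoments.exists_const_currentNormSq_ge`): choose `s³ = εc/(4A₁(C_Ψ+1))` and `N` large.
3. The refutation `not_OddCorrectorDecay : ¬ OddCorrectorDecay` is the one-line consequence
   (`OddSectorIrreversibilityOddCorrectorDecayRefutation.lean`).
-/

noncomputable section

open MeasureTheory ProbabilityTheory Filter Topology Set Function Finset intervalIntegral
open scoped NNReal ENNReal
open Literature.Probability.Process
open Literature.MathematicalPhysics.KineticTheory Literature.MathematicalPhysics.KineticTheory.HeatConduction
open Literature.MathematicalPhysics.KineticTheory.OddSectorLocality
open Summit.AtomisticToContinuum.FouriersLaw.Theorems.ClosedChainKoopman (memLp_two_totalCurrent)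
open Summit.AtomisticToContinuum.FouriersLaw.Theorems.ChainVariation

namespace Summit.AtomisticToContinuum.FouriersLaw.Theorems.OddCorrectorBathLocality

/-! ### Jensen in the Markov kernel -/

section Reduction

variable {ω₂ lam β γ T : ℝ} (hω : 0 < ω₂) (hl : 0 ≤ lam) (hβ : 0 ≤ β) (hγ : 0 ≤ γ) {N : ℕ} (hN : 0 < N)
  (hT : 0 < T)
include hω hl hβ hγ hN hT

/-- **Jensen in the Markov kernel, `μ_T`-a.e.**: for `t ≥ 0`,
`∫⁻ (P_tJ(x) - J(φ_t x))² dμ_T(x) ≤ ∫⁻ (J(Φ_t(x,B(ω))) - J(φ_t x))² d(μ_T ⊗ P)(x,ω)`. [folklore] -/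
theorem lintegral_sq_forecast_sub_le {t : ℝ} (ht : 0 ≤ t) :
    ∫⁻ x, ENNReal.ofReal ((currentForecast ω₂ lam β γ T N t x -
        (∑ i, (pinnedChain ω₂ lam β γ).bondCurrent N i ((pinnedChain ω₂ lam β 0).chainFlow N x 0 t))) ^ 2) ∂(gibbsWeight ω₂ lam β γ T N) ≤
      ∫⁻ p, ENNReal.ofReal (((∑ i, (pinnedChain ω₂ lam β γ).bondCurrent N i ((pinnedChain ω₂ lam β γ).chainFlow N p.1 (chainNoise N (Real.sqrt (2 * (pinnedChain ω₂ lam β γ).γ * T)) (Real.sqrt (2 * (pinnedChain ω₂ lam β γ).γ * T)) (pairPath p.2)) t)) -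
        (∑ i, (pinnedChain ω₂ lam β γ).bondCurrent N i ((pinnedChain ω₂ lam β 0).chainFlow N p.1 0 t))) ^ 2) ∂((gibbsWeight ω₂ lam β γ T N).prod wienerPair) := by
  set μ : Measure (PhaseSpace N) := (gibbsWeight ω₂ lam β γ T N) with hμ
  haveI : SFinite μ := by rw [hμ]; unfold gibbsWeight; infer_instance
  set P := (pinnedChain ω₂ lam β γ) with hP
  set κ := P.transitionKernel N T T t.toNNReal with hκ
  haveI : IsMarkovKernel κ := pinnedChain_isMarkovKernel_transitionKernel hω hl hβ hγ N T T _
  set J : PhaseSpace N → ℝ := fun v => ∑ i, P.bondCurrent N i v with hJ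
  set φ : PhaseSpace N → PhaseSpace N := fun x => (pinnedChain ω₂ lam β 0).chainFlow N x 0 t with hφ
  have hJc : Continuous J := continuous_finsetSum _ fun i _ => pinnedChain_continuous_bondCurrent ω₂ lam β γ N i
  have hJm : Measurable J := hJc.measurable
  have h0 : Continuous (0 : ℝ → Fin N → ℝ) := continuous_const
  have hφc : Continuous φ := pinnedChain_continuous_chainFlow_left hω hl hβ le_rfl N h0 t
  have hJmem : MemLp J 2 μ := memLp_two_totalCurrent hω hl hβ γ N hT
  -- `∫⁻∫⁻ J² dκ dμ = ∫⁻ J² dμ < ∞`, so `J ∈ L²(κ x)` for a.e. `x`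
  have hg : Measurable fun y => ENNReal.ofReal (J y ^ 2) := (hJm.pow_const 2).ennreal_ofReal
  have hinv := lintegral_transitionKernel_gibbsWeight hω hl hβ hγ hN hT t.toNNReal hg
  have hfin : ∫⁻ y, ENNReal.ofReal (J y ^ 2) ∂μ < ∞ := by
    have h := hJmem.integrable_sq.hasFiniteIntegral
    rw [hasFiniteIntegral_iff_ofReal (Eventually.of_forall fun x => sq_nonneg (J x))] at h
    exact h
  have hae : ∀ᵐ x ∂μ, ∫⁻ y, ENNReal.ofReal (J y ^ 2) ∂κ x < ∞ := by
    refine ae_lt_top (hg.lintegral_kernel) ?_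
    rw [hinv]; exact hfin.ne
  have ht' : ((t.toNNReal : ℝ≥0) : ℝ) = t := Real.coe_toNNReal t ht
  -- pointwise (a.e.) Jensen
  have hpt : ∀ᵐ x ∂μ, ENNReal.ofReal ((currentForecast ω₂ lam β γ T N t x - J (φ x)) ^ 2) ≤
      ∫⁻ ω, ENNReal.ofReal ((J (P.solMap N T T t x (pairPath ω)) - J (φ x)) ^ 2) ∂wienerPair := by
    refine hae.mono fun x hx => ?_
    have hmem : MemLp J 2 (κ x) := by
      rw [memLp_two_iff_integrable_sq hJc.aestronglyMeasurable]
      refine ⟨(hJm.pow_const 2).aestronglyMeasurable, ?_⟩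
      rw [hasFiniteIntegral_iff_ofReal (Eventually.of_forall fun y => sq_nonneg (J y))]
      exact hx
    set a : ℝ := J (φ x) with ha
    have hmem' : MemLp (fun y => J y - a) 2 (κ x) := hmem.sub (memLp_const a)
    have hcf : currentForecast ω₂ lam β γ T N t x = ∫ y, J y ∂κ x := rfl
    have hsub : ∫ y, (J y - a) ∂κ x = (∫ y, J y ∂κ x) - a := by
      rw [MeasureTheory.integral_sub (hmem.integrable one_le_two) (integrable_const a), MeasureTheory.integral_const]
      simp
    have hvar := variance_nonneg (fun y => J y - a) (κ x)
    rw [variance_eq_sub hmem'] at hvar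
    have hsq : ((∫ y, J y ∂κ x) - a) ^ 2 ≤ ∫ y, (J y - a) ^ 2 ∂κ x := by
      have e1 : (κ x)[(fun y => J y - a) ^ 2] = ∫ y, (J y - a) ^ 2 ∂κ x := rfl
      have e2 : (κ x)[fun y => J y - a] = (∫ y, J y ∂κ x) - a := hsub
      rw [e1, e2] at hvar
      linarith
    have hint2 : Integrable (fun y => (J y - a) ^ 2) (κ x) := hmem'.integrable_sq
    calc ENNReal.ofReal ((currentForecast ω₂ lam β γ T N t x - J (φ x)) ^ 2)
        = ENNReal.ofReal (((∫ y, J y ∂κ x) - a) ^ 2) := by rw [hcf]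
      _ ≤ ENNReal.ofReal (∫ y, (J y - a) ^ 2 ∂κ x) := ENNReal.ofReal_le_ofReal hsq
      _ = ∫⁻ y, ENNReal.ofReal ((J y - a) ^ 2) ∂κ x :=
          ofReal_integral_eq_lintegral_ofReal hint2 (Eventually.of_forall fun y => sq_nonneg _)
      _ = ∫⁻ ω, ENNReal.ofReal ((J (P.solMap N T T t x (pairPath ω)) - a) ^ 2) ∂wienerPair := by
          have hgm' : Measurable fun y => ENNReal.ofReal ((J y - a) ^ 2) :=
            ((hJm.sub measurable_const).pow_const 2).ennreal_ofReal
          rw [hκ, pinnedChain_lintegral_transitionKernel hω hl hβ hγ N T T t.toNNReal x hgm', ht']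
  -- integrate and use Tonelli
  have hmeas : Measurable fun p : PhaseSpace N × WienerPair =>
      ENNReal.ofReal ((J (P.solMap N T T t p.1 (pairPath p.2)) - J (φ p.1)) ^ 2) := by
    have h1 : Measurable fun p : PhaseSpace N × WienerPair => P.solMap N T T t p.1 (pairPath p.2) :=
      pinnedChain_measurable_solMap_pairPath hω hl hβ hγ N T T t
    exact (((hJm.comp h1).sub (hJm.comp (hφc.measurable.comp measurable_fst))).pow_const 2).ennreal_ofReal
  calc ∫⁻ x, ENNReal.ofReal ((currentForecast ω₂ lam β γ T N t x - J (φ x)) ^ 2) ∂μ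
      ≤ ∫⁻ x, ∫⁻ ω, ENNReal.ofReal ((J (P.solMap N T T t x (pairPath ω)) - J (φ x)) ^ 2) ∂wienerPair ∂μ :=
        lintegral_mono_ae hpt
    _ = ∫⁻ p, ENNReal.ofReal ((J (P.solMap N T T t p.1 (pairPath p.2)) - J (φ p.1)) ^ 2) ∂(μ.prod wienerPair) :=
        (lintegral_prod _ hmeas.aemeasurable).symm
    _ = _ := rfl

end Reduction

/-! ### Bath locality and the refutation of the crux -/

/-- The AM–GM parameter choice: `(εc/(4A₁(C+1))) A₁ (C N) ≤ (εc/4) N`. [folklore] -/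
theorem amgm_param_bound {ε c A₁ C Nr : ℝ} (hε : 0 < ε) (hc : 0 < c) (hA : 0 < A₁) (hC : 0 ≤ C) (hN : 0 ≤ Nr) :
    ε * c / (4 * A₁ * (C + 1)) * A₁ * (C * Nr) ≤ ε * c / 4 * Nr := by
  have e : ε * c / (4 * A₁ * (C + 1)) * A₁ * (C * Nr) = ε * c / 4 * Nr * (C / (C + 1)) := by
    field_simp
  rw [e]
  have hC1 : C / (C + 1) ≤ 1 := (div_le_one (by positivity)).2 (by linarith)
  have hpos : 0 ≤ ε * c / 4 * Nr := by positivity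
  nlinarith

/-- The length choice: `a (4/(3k)) ≤ n` gives `a ≤ (3/4) k n`. [folklore] -/
theorem length_bound {a k n : ℝ} (hk : 0 < k) (h : a * (4 / (3 * k)) ≤ n) : a ≤ 3 / 4 * k * n := by
  have h' := mul_le_mul_of_nonneg_right h (le_of_lt (by positivity : (0:ℝ) < 3 / 4 * k))
  have e : a * (4 / (3 * k)) * (3 / 4 * k) = a := by field_simp
  rw [e] at h'
  linarith

section Final

variable {ω₂ lam β γ T : ℝ} (hω : 0 < ω₂) (hl : 0 < lam) (hβ : 0 ≤ β) (hγ : 0 ≤ γ) (hT : 0 < T)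
include hω hl hβ hγ hT

/-- **Bath locality of the equilibrium pinned chain at fixed time** (the hypothesis of
`oddCorrectorDecay_false_of_bathLocality_at`, now a theorem): for every horizon `t₀ > 0` and `ε > 0` there is a
length `N` with `M_N > 0` and `∫ (P_tJ - J∘φ_t)² dμ_T ≤ ε M_N` for all `t ∈ [0, t₀]`. [folklore] -/
theorem bathLocality (t₀ : ℝ) (ht₀ : 0 < t₀) (ε : ℝ) (hε : 0 < ε) :
    ∃ N : ℕ, 0 < currentNormSq ω₂ lam β γ T N ∧
      ∀ t ∈ Icc (0:ℝ) t₀,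
        ∫ x, (currentForecast ω₂ lam β γ T N t x -
            ∑ i : Fin N, (pinnedChain ω₂ lam β γ).bondCurrent N i
              ((pinnedChain ω₂ lam β 0).chainFlow N x 0 t)) ^ 2 ∂(gibbsWeight ω₂ lam β γ T N) ≤
          ε * currentNormSq ω₂ lam β γ T N := by
  -- the one-site rate and the static constants
  obtain ⟨κ, hκdef⟩ : ∃ κ : ℝ, κ = (4 + 24 * β) + 144 * β + 6 * t₀ * (3 * lam + 48 * β) := ⟨_, rfl⟩
  have h348 : (0:ℝ) ≤ 6 * t₀ * (3 * lam + 48 * β) := by positivity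
  have hκ0 : 0 ≤ κ := by rw [hκdef]; positivity
  have hκ₁ : 4 + 24 * β ≤ κ := by rw [hκdef]; linarith [mul_nonneg (by norm_num : (0:ℝ) ≤ 144) hβ]
  have hκ₂ : 144 * β ≤ κ := by rw [hκdef]; linarith [mul_nonneg (by norm_num : (0:ℝ) ≤ 24) hβ]
  have hκ₃ : 6 * t₀ * (3 * lam + 48 * β) ≤ κ := by
    rw [hκdef]; linarith [mul_nonneg (by norm_num : (0:ℝ) ≤ 24) hβ, mul_nonneg (by norm_num : (0:ℝ) ≤ 144) hβ]
  obtain ⟨CΨ, hCΨ0, hCΨ⟩ := exists_const_lintegral_oneSiteSum_le hω hl hβ γ hT hκ0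
  obtain ⟨c, hc, hcM⟩ := exists_const_currentNormSq_ge hω hl.le hβ γ hT
  obtain ⟨A₁, hA₁⟩ : ∃ A₁ : ℝ, A₁ = (2 * 1216 + 2 * Real.exp (6 * t₀ * (ω₂ + 4))) / 3 := ⟨_, rfl⟩
  obtain ⟨A₂, hA₂⟩ : ∃ A₂ : ℝ, A₂ =
      (32768 * (Real.sqrt (2 * (pinnedChain ω₂ lam β γ).γ * T)) ^ 6 * (2880 * Real.exp (t₀ / 2)) +
        32768 * t₀ ^ 5 * (Real.sqrt (2 * (pinnedChain ω₂ lam β γ).γ * T)) ^ 6 * ((2880 * Real.exp (t₀ / 2)) * t₀) +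
        1048576 * γ ^ 6 * t₀ ^ 5 * (1 + t₀ ^ 6) * (1440 * T ^ 3 * t₀)) / 3 := ⟨_, rfl⟩
  have hA₁0 : 0 < A₁ := by rw [hA₁]; positivity
  have hA₂0 : 0 ≤ A₂ := by rw [hA₂]; positivity
  -- the AM–GM parameter: `s³ = ε c / (4 A₁ (CΨ + 1))`
  obtain ⟨m, hm⟩ : ∃ m : ℝ, m = ε * c / (4 * A₁ * (CΨ + 1)) := ⟨_, rfl⟩
  have hm0 : 0 < m := by rw [hm]; positivity
  obtain ⟨s, hs, hs3⟩ : ∃ s : ℝ, 0 < s ∧ s ^ 3 = m := by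
    refine ⟨m ^ ((1:ℝ) / 3), Real.rpow_pos_of_pos hm0 _, ?_⟩
    rw [← Real.rpow_natCast, ← Real.rpow_mul hm0.le]; norm_num
  -- the length
  obtain ⟨X, hX⟩ : ∃ X : ℝ, X = (A₂ / s ^ 6) * (4 / (3 * (ε * c))) := ⟨_, rfl⟩
  set n : ℕ := ⌈X⌉₊ with hn
  have hnX : X ≤ n := Nat.le_ceil X
  have hN : 0 < n + 3 := by omega
  have hZtop : gibbsWeight ω₂ lam β γ T (n + 3) univ ≠ ⊤ :=
    (isFiniteMeasure_gibbsWeight hω hl.le hβ γ hT (n + 3)).measure_univ_lt_top.ne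
  have hZ0 : gibbsWeight ω₂ lam β γ T (n + 3) univ ≠ 0 := gibbsWeight_univ_ne_zero hω hl.le hβ γ hT (n + 3)
  obtain ⟨Zr, hZr⟩ : ∃ Zr : ℝ, Zr = (gibbsWeight ω₂ lam β γ T (n + 3) univ).toReal := ⟨_, rfl⟩
  have hZpos : 0 < Zr := by rw [hZr]; exact ENNReal.toReal_pos hZ0 hZtop
  have hZeq : gibbsWeight ω₂ lam β γ T (n + 3) univ = ENNReal.ofReal Zr := by
    rw [hZr, ENNReal.ofReal_toReal hZtop]
  have hMge : c * (n + 1) * Zr ≤ currentNormSq ω₂ lam β γ T (n + 3) := by rw [hZr]; exact hcM n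
  have hMpos : 0 < currentNormSq ω₂ lam β γ T (n + 3) := lt_of_lt_of_le (by positivity) hMge
  refine ⟨n + 3, hMpos, fun t ht => ?_⟩
  set g : PhaseSpace (n + 3) → ℝ := fun x => (currentForecast ω₂ lam β γ T (n + 3) t x -
    ∑ i : Fin (n + 3), (pinnedChain ω₂ lam β γ).bondCurrent (n + 3) i
      ((pinnedChain ω₂ lam β 0).chainFlow (n + 3) x 0 t)) ^ 2 with hg
  rcases eq_or_lt_of_le ht.1 with h0 | htpos
  · -- `t = 0`: the integrand vanishes
    have hzero : ∀ x, g x = 0 := by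
      intro x
      have hfl := pinnedChain_chainFlow_of_nonpos ω₂ lam β 0 (n + 3) x (η := 0) continuous_const (le_of_eq h0.symm)
      have h0' : (pinnedChain ω₂ lam β 0).chainFlow (n + 3) x 0 t = x := by rw [hfl]; simp
      rw [hg]
      simp only
      rw [h0', ← h0, currentForecast_zero hω hl.le hβ hγ T (n + 3) x, sub_self]
      ring
    have hint0 : ∫ x, g x ∂(gibbsWeight ω₂ lam β γ T (n + 3)) = 0 := by
      rw [show g = fun _ => (0:ℝ) from funext hzero]
      exact MeasureTheory.integral_zero _ _
    calc ∫ x, g x ∂(gibbsWeight ω₂ lam β γ T (n + 3)) = 0 := hint0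
      _ ≤ ε * currentNormSq ω₂ lam β γ T (n + 3) := by positivity
  -- `0 < t ≤ t₀`
  haveI : SFinite (gibbsWeight ω₂ lam β γ T (n + 3)) := by unfold gibbsWeight; infer_instance
  have hD := lintegral_sq_forecast_sub_le hω hl.le hβ hγ hN hT ht.1
  have hE := lintegral_sq_currentDiff_le hω hl hβ hγ hN hT htpos ht.2 hs hκ₁ hκ₂ hκ₃
  rw [← hA₁, ← hA₂] at hE
  have hΨN := hCΨ (n + 3)
  -- the Lebesgue bound
  have hL : ∫⁻ x, ENNReal.ofReal (g x) ∂(gibbsWeight ω₂ lam β γ T (n + 3)) ≤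
      ENNReal.ofReal ((s ^ 3 * A₁ * (CΨ * (n + 3 : ℕ)) + A₂ / s ^ 6) * Zr) := by
    have h1 : ∫⁻ x, ENNReal.ofReal (g x) ∂(gibbsWeight ω₂ lam β γ T (n + 3)) ≤
        ENNReal.ofReal (s ^ 3 * A₁) * (ENNReal.ofReal (CΨ * (n + 3 : ℕ)) * gibbsWeight ω₂ lam β γ T (n + 3) univ) +
          ENNReal.ofReal (A₂ / s ^ 6) * gibbsWeight ω₂ lam β γ T (n + 3) univ :=
      (hD.trans hE).trans (add_le_add (mul_le_mul_right hΨN _) le_rfl)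
    refine h1.trans (le_of_eq ?_)
    rw [hZeq, ← ENNReal.ofReal_mul (by positivity), ← ENNReal.ofReal_mul (by positivity),
      ← ENNReal.ofReal_mul (div_nonneg hA₂0 (by positivity)),
      ← ENNReal.ofReal_add (by positivity) (mul_nonneg (div_nonneg hA₂0 (by positivity)) hZpos.le)]
    congr 1
    ring
  -- back to the Bochner integral
  have hgm : AEStronglyMeasurable g (gibbsWeight ω₂ lam β γ T (n + 3)) := by
    have hJc : Continuous fun v : PhaseSpace (n + 3) => ∑ i : Fin (n + 3), (pinnedChain ω₂ lam β γ).bondCurrent (n + 3) i v :=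
      continuous_finsetSum _ fun i _ => pinnedChain_continuous_bondCurrent ω₂ lam β γ (n + 3) i
    have hcf : StronglyMeasurable (currentForecast ω₂ lam β γ T (n + 3) t) :=
      hJc.stronglyMeasurable.integral_kernel
    have h0c : Continuous (0 : ℝ → Fin (n + 3) → ℝ) := continuous_const
    have hφ : Continuous fun x : PhaseSpace (n + 3) => (pinnedChain ω₂ lam β 0).chainFlow (n + 3) x 0 t :=
      pinnedChain_continuous_chainFlow_left hω hl.le hβ le_rfl (n + 3) h0c t
    exact ((hcf.measurable.sub (hJc.comp hφ).measurable).pow_const 2).aestronglyMeasurable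
  have hg0 : 0 ≤ᵐ[gibbsWeight ω₂ lam β γ T (n + 3)] g := Eventually.of_forall fun x => sq_nonneg _
  have hreal : ∫ x, g x ∂(gibbsWeight ω₂ lam β γ T (n + 3)) ≤ (s ^ 3 * A₁ * (CΨ * (n + 3 : ℕ)) + A₂ / s ^ 6) * Zr := by
    rw [integral_eq_lintegral_of_nonneg_ae hg0 hgm]
    have := ENNReal.toReal_mono ENNReal.ofReal_ne_top hL
    rwa [ENNReal.toReal_ofReal (mul_nonneg (add_nonneg (by positivity) (div_nonneg hA₂0 (by positivity))) hZpos.le)]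
      at this
  -- arithmetic: `s³ A₁ CΨ N + A₂/s⁶ ≤ ε c (n+1)` by the choice of `s` and `n`
  have hεc : 0 < ε * c := by positivity
  have h1 : s ^ 3 * A₁ * (CΨ * (n + 3 : ℕ)) ≤ ε * c / 4 * (n + 3 : ℕ) := by
    rw [hs3, hm]
    exact amgm_param_bound hε hc hA₁0 hCΨ0 (Nat.cast_nonneg _)
  have h2 : A₂ / s ^ 6 ≤ 3 / 4 * (ε * c) * n := by
    rw [hX] at hnX
    exact length_bound hεc hnX
  have hkey : (s ^ 3 * A₁ * (CΨ * (n + 3 : ℕ)) + A₂ / s ^ 6) ≤ ε * (c * (n + 1)) := by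
    have e : ((n + 3 : ℕ) : ℝ) = n + 3 := by push_cast; ring
    rw [e] at h1 ⊢
    linarith [h1, h2, hεc]
  calc ∫ x, g x ∂(gibbsWeight ω₂ lam β γ T (n + 3)) ≤ (s ^ 3 * A₁ * (CΨ * (n + 3 : ℕ)) + A₂ / s ^ 6) * Zr := hreal
    _ ≤ ε * (c * (n + 1)) * Zr := mul_le_mul_of_nonneg_right hkey hZpos.le
    _ = ε * (c * (n + 1) * Zr) := by ring
    _ ≤ ε * currentNormSq ω₂ lam β γ T (n + 3) := mul_le_mul_of_nonneg_left hMge hε.le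

end Final

end Summit.AtomisticToContinuum.FouriersLaw.Theorems.OddCorrectorBathLocality

end
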